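import Summits.Ventures.WeilGRH.UniformConductorFloorJointFloorsLog11
import Summits.Ventures.WeilGRH.UniformConductorFloorJointEvenLog12Check
import Summits.Ventures.WeilGRH.UniformConductorFloorJointEvenLog12CheckB
import Summits.Ventures.WeilGRH.UniformConductorFloorJointOddLog12Check
import Summits.Ventures.WeilGRH.UniformConductorFloorJointOddLog12CheckB
import Summits.Ventures.WeilGRH.UniformConductorFloorCellsOne
import Summits.Ventures.WeilGRH.UniformConductorFloorRungs
import HarnessLib

/-!
# GRH arm (rh-explicit, venture WeilGRH): ★ the rung `t = (log 12)/2` for EVERY Dirichlet character of EVERY modulus `q ≥ 296` (odd characters: `q ≥ 98`) — the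
  joint cell certificates (rung six)

Cell `rh-explicit`, WEIL TRACK — GRH ARM (weil-grh-1, gen9).  The uniform conductor floor at the sixth rung `t = (log 12)/2` (prime powers `2, 3, 4, 5, 7, 8, 9, 11` inside
the window), from `certEvenLog12` / `certOddLog12` (`UniformConductorFloorJointDataLog12.lean`; `R = 320`, `J = 398`, `t = 398 log(320/319) = 1.245697 ≥ (log 12)/2 = 1.242453`,
`N = 12` — `e^{2t} = 12.08`; weights `0` at `10`, `12` and the genuine weight at the prime `11`, which is inside the window at this rung),
kernel-checked in `…Joint{Even,Odd}Log11Check(B).lean`, through `JointCert.weilPositivityOnChar_of_parts`: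

* ★ `weilPositivityOnChar_log12half_of_ge_296` — EVERY Dirichlet character of EVERY modulus `q ≥ 296` satisfies `WeilPositivityOnChar χ ((log 12)/2)`;
* ★ `weilPositivityOnChar_log12half_of_odd_ge_98` — every ODD character of every modulus `q ≥ 98`.

With the flat-window failures at this rung (`UniformConductorFloorPrincipalLog12.lean`: every prime `p ≤ 271`) the PRIME statement at `(log 12)/2` reads
«`p ≤ 271` fails, `p ≥ 307` holds» (`307` = the least prime `≥ 296`), the primes `277` (RAZOR: flat `271.53`, Galerkin bottoms `277.02 / 277.05 / 277.13` at
`28 / 32 / 48` modes — expected FALSE by a table-based witness), `281`, `283`, `293` (expected TRUE: door cells on a `(log 12)/2` table, margins ≈ `0.014 / 0.021 / 0.056`)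
being open.  Inputs: the standard weights padded to `N = 12` (`hw_of_weights12`: `Λ(10) = Λ(12) = 0`, `Λ(11)/√11 ≤ 785698/2^20` from
`UniformConductorFloorJointFloorsLog11.vonMangoldt_eleven_div_sqrt_le`), `psi_even_ge` / `psi_odd_ge`, `log 296 ≥ 5 log 2 + 2 log 3 + 8/296`, `log 98 ≥ 5 log 2 + log 3 + 2/98`,
and `12·319^796 ≤ 320^796` for the window.  Method floors 294.98 / 97.57; no `ζ` input; standard axioms.

## References

* A. Weil (1952), (11) pp. 261–262 and the «lemme» p. 262 [Weil1952FormulesExplicites]; L. Collatz (1942) / H. Wielandt (1950). [folklore]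
-/

noncomputable section

open Real Set
open scoped ArithmeticFunction.vonMangoldt

namespace Summit.Ventures.WeilGRH

open Literature.NumberTheory.LFunctions

namespace UniformFloor

variable {q : ℕ}

/-! ## Inputs -/

/-- The weights of a `JointCert` with the standard table padded to `N = 12` (weights `0` at the non-prime-powers `10`, `12`, `785698` at the prime `11`) dominate `Λ(n)/√n`.
[folklore] -/
theorem hw_of_weights12 (c : JointCert) (hN : c.N = 12) (hD : c.D = 1048576)
    (hW : c.weights = [0, 0, 513950, 665112, 363409, 754726, 0, 771213, 256975, 383993, 0, 785698, 0]) :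
    ∀ n ∈ Finset.range (c.N + 1), (Λ n : ℝ) / Real.sqrt n ≤ c.wbar n := by
  intro n hn
  rw [hN] at hn
  have hn13 : n < 13 := by simpa using Finset.mem_range.1 hn
  unfold JointCert.wbar
  rw [hD, hW]
  have h7 : ∀ m < 8, (Λ m : ℝ) / Real.sqrt m ≤ wbar7 m := fun m hm ↦
    wbar7_ge 7 le_rfl m (Finset.mem_range.2 (by omega))
  interval_cases n
  · exact (h7 0 (by norm_num)).trans (by norm_num [wbar7])
  · exact (h7 1 (by norm_num)).trans (by norm_num [wbar7])
  · exact (h7 2 (by norm_num)).trans (by norm_num [wbar7])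
  · exact (h7 3 (by norm_num)).trans (by norm_num [wbar7])
  · exact (h7 4 (by norm_num)).trans (by norm_num [wbar7])
  · exact (h7 5 (by norm_num)).trans (by norm_num [wbar7])
  · exact (h7 6 (by norm_num)).trans (by norm_num [wbar7])
  · exact (h7 7 (by norm_num)).trans (by norm_num [wbar7])
  · simpa using vonMangoldt_eight_div_sqrt_le
  · simpa using vonMangoldt_nine_div_sqrt_le
  · have h10 : (Λ 10 : ℝ) = 0 := by
      rw [ArithmeticFunction.vonMangoldt_eq_zero_iff.mpr (by decide : ¬ IsPrimePow 10)]
    rw [h10]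
    norm_num
  · simpa using vonMangoldt_eleven_div_sqrt_le
  · have h12 : (Λ 12 : ℝ) = 0 := by
      rw [ArithmeticFunction.vonMangoldt_eq_zero_iff.mpr (by decide : ¬ IsPrimePow 12)]
    rw [h12]
    norm_num

/-- `(log 12)/2 ≤ 398 log(320/319)` (`12·319^796 ≤ 320^796`). [folklore] -/
theorem log12half_le_t (c : JointCert) (hR : c.R = 320) (hJ : c.J = 398) : Real.log 12 / 2 ≤ c.t := by
  rw [JointCert.t_eq_log, hR, hJ]
  have h : Real.log 12 ≤ Real.log (((((320 : ℕ) : ℝ) / (((320 : ℕ) : ℝ) - 1)) ^ 398) ^ 2) := by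
    refine Real.log_le_log (by norm_num) ?_
    rw [← pow_mul, div_pow, le_div_iff₀ (by norm_num)]
    have h0 : (12 : ℝ) * 319 ^ 796 ≤ 320 ^ 796 := by exact_mod_cast (by decide +kernel : 12 * 319 ^ 796 ≤ 320 ^ 796)
    norm_num
    exact h0
  rw [Real.log_pow] at h
  push_cast at h ⊢
  linarith

/-- The budget of `certEvenLog12`: `log π − (−4.22745354) − Clow/D + RHO/D = 5.686911 ≤ log 296` (`log 296 ≥ 5 log 2 + 2 log 3 + 8/296 = 5.689988`).
[folklore] -/
theorem certEvenLog12_budget :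
    Real.log Real.pi - (-4.22745354) - (certEvenLog12.Clow : ℝ) / certEvenLog12.D + (certEvenLog12.RHO : ℝ) / certEvenLog12.D ≤ Real.log (296 : ℕ) := by
  have hπ := Literature.Analysis.SpecialFunctions.Real.log_pi_le
  have h2 := Real.log_two_gt_d9
  have h3 := Real.log_three_gt_d9
  have hl : Real.log ((288 : ℝ) / 296) ≤ 288 / 296 - 1 := Real.log_le_sub_one_of_pos (by norm_num)
  have hS : Real.log (288 : ℝ) = 5 * Real.log 2 + 2 * Real.log 3 := by
    rw [show (288 : ℝ) = 2 ^ 5 * 3 ^ 2 by norm_num, Real.log_mul (by norm_num) (by norm_num), Real.log_pow, Real.log_pow]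
    push_cast
    ring
  rw [Real.log_div (by norm_num) (by norm_num), hS] at hl
  rw [show certEvenLog12.Clow = 7676641 from rfl, show certEvenLog12.D = 1048576 from rfl, show certEvenLog12.RHO = 8006657 from rfl]
  push_cast at *
  linarith

/-- The budget of `certOddLog12`: `… = 4.580526 ≤ log 98` (`log 98 ≥ 5 log 2 + log 3 + 2/98 = 4.584756`). [folklore] -/
theorem certOddLog12_budget :
    Real.log Real.pi - (-1.08586154) - (certOddLog12.Clow : ℝ) / certOddLog12.D + (certOddLog12.RHO : ℝ) / certOddLog12.D ≤ Real.log (98 : ℕ) := by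
  have hπ := Literature.Analysis.SpecialFunctions.Real.log_pi_le
  have h2 := Real.log_two_gt_d9
  have h3 := Real.log_three_gt_d9
  have hl : Real.log ((96 : ℝ) / 98) ≤ 96 / 98 - 1 := Real.log_le_sub_one_of_pos (by norm_num)
  have hS : Real.log (96 : ℝ) = 5 * Real.log 2 + 1 * Real.log 3 := by
    rw [show (96 : ℝ) = 2 ^ 5 * 3 ^ 1 by norm_num, Real.log_mul (by norm_num) (by norm_num), Real.log_pow, Real.log_pow]
    push_cast
    ring
  rw [Real.log_div (by norm_num) (by norm_num), hS] at hl
  rw [show certOddLog12.Clow = 4399981 from rfl, show certOddLog12.D = 1048576 from rfl, show certOddLog12.RHO = 6864066 from rfl]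
  push_cast at *
  linarith

/-! ## The cells, reassembled from the two kernel ranges -/

/-- All `398` cells of `certEvenLog12`. [folklore] -/
theorem certEvenLog12_cells : ∀ j < certEvenLog12.J, certEvenLog12.cellOKB j = true := by
  intro j hj
  have hJ : certEvenLog12.J = 398 := rfl
  by_cases h : j < 199
  · exact certEvenLog12.cellsLoop_spec 199 0 (by omega) certEvenLog12_cellsA j (Nat.zero_le _) (by omega)
  · exact certEvenLog12.cellsLoop_spec 199 199 (by omega) certEvenLog12_cellsB j (by omega) (by omega)

/-- All `398` cells of `certOddLog12`. [folklore] -/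
theorem certOddLog12_cells : ∀ j < certOddLog12.J, certOddLog12.cellOKB j = true := by
  intro j hj
  have hJ : certOddLog12.J = 398 := rfl
  by_cases h : j < 199
  · exact certOddLog12.cellsLoop_spec 199 0 (by omega) certOddLog12_cellsA j (Nat.zero_le _) (by omega)
  · exact certOddLog12.cellsLoop_spec 199 199 (by omega) certOddLog12_cellsB j (by omega) (by omega)

/-! ## The floors -/

/-- ★ Every EVEN character of every modulus `q ≥ 296` at the rung `(log 12)/2`. [folklore] -/
theorem weilPositivityOnChar_log12half_of_even_ge_296 (hq : 296 ≤ q) (χ : DirichletCharacter ℂ q) (hpar : charParity χ = 0) :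
    WeilPositivityOnChar χ (Real.log 12 / 2) := by
  have h := certEvenLog12.weilPositivityOnChar_of_parts certEvenLog12_checkFrame certEvenLog12_cells
    (hw_of_weights12 certEvenLog12 rfl rfl rfl) psi_even_ge (Q₀ := 296) (by norm_num) certEvenLog12_budget (by omega) hq χ hpar
  have ht := log12half_le_t certEvenLog12 rfl rfl
  exact fun g hg hsupp ↦ h g hg (hsupp.trans (Icc_subset_Icc (by linarith) ht))

/-- ★ Every ODD character of every modulus `q ≥ 98` at the rung `(log 12)/2`. [cite: Weil1952FormulesExplicites, (11) and the «lemme» p. 262] -/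
theorem weilPositivityOnChar_log12half_of_odd_ge_98 (hq : 98 ≤ q) (χ : DirichletCharacter ℂ q) (hpar : charParity χ = 1) :
    WeilPositivityOnChar χ (Real.log 12 / 2) := by
  have h := certOddLog12.weilPositivityOnChar_of_parts certOddLog12_checkFrame certOddLog12_cells
    (hw_of_weights12 certOddLog12 rfl rfl rfl) psi_odd_ge (Q₀ := 98) (by norm_num) certOddLog12_budget (by omega) hq χ hpar
  have ht := log12half_le_t certOddLog12 rfl rfl
  exact fun g hg hsupp ↦ h g hg (hsupp.trans (Icc_subset_Icc (by linarith) ht))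

/-- ★★ **EVERY Dirichlet character of EVERY modulus `q ≥ 296` satisfies Weil positivity on `[−(log 12)/2, (log 12)/2]`.**
[cite: Weil1952FormulesExplicites, (11) and the «lemme» p. 262] -/
theorem weilPositivityOnChar_log12half_of_ge_296 (hq : 296 ≤ q) (χ : DirichletCharacter ℂ q) : WeilPositivityOnChar χ (Real.log 12 / 2) := by
  rcases Nat.le_one_iff_eq_zero_or_eq_one.1 (charParity_le_one χ) with h | h
  · exact weilPositivityOnChar_log12half_of_even_ge_296 hq χ h
  · exact weilPositivityOnChar_log12half_of_odd_ge_98 (by omega) χ h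

/-- The same on every window `t ≤ (log 12)/2`. [folklore] -/
theorem weilPositivityOnChar_of_le_log12half_of_ge_296 (hq : 296 ≤ q) (χ : DirichletCharacter ℂ q) {t : ℝ} (ht : t ≤ Real.log 12 / 2) :
    WeilPositivityOnChar χ t := fun g hg hsupp ↦
  weilPositivityOnChar_log12half_of_ge_296 hq χ g hg (hsupp.trans (Icc_subset_Icc (by linarith) ht))

end UniformFloor

end Summit.Ventures.WeilGRH

end
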